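import Literature.Barriers.Parity.SiegelZeroDichotomy
import HarnessLib
import Summits.Parity.GeneralizedHardyLittlewood.Theorems.UnboundedSiegelZeros

/-!
# Siegel zeros ⇒ Chowla's `k`-point conjecture along a subsequence (Chinis 2026)

Statement layer for the «illusory world» column (conditional consequences of Siegel zeros), topic
«Chowla / Liouville correlations» — one more PUBLISHED source next to the tree's
`Literature.Barriers.Parity.TaoTeravainen2021_chowla` (Tao–Teräväinen, Cor. 1.8(ii)) and
`Literature.NumberTheory.LFunctions.jaskariSachpazis2025_theorem11`. Source: J. Chinis, *Siegel
zeros and Sarnak's conjecture*, J. London Math. Soc. (2) 113 (2026), no. 3 [Chinis2026]; held copy =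
arXiv:2105.14653 (tex), §1 Theorems 1.1 (Germán–Kátai) and 1.2, Remark 1.3, Corollary 1.1, §2.

Theorem 1.2: if `χ_ℓ mod q_ℓ` are real primitive characters whose `L`-functions have Siegel zeros
`β_ℓ = 1 − 1/(η_ℓ log q_ℓ)` of large quality `η_ℓ`, then for distinct positive shifts `h₁, …, h_k`,
`(1/x) |∑_{n ≤ x} λ(n+h₁)⋯λ(n+h_k)| ≤ c_k (log log η_ℓ)^{−1/2} (log η_ℓ)^{−1/12}` uniformly for
`x ∈ [q_ℓ^{10}, q_ℓ^{(log log η_ℓ)/3}]`; «since `η_ℓ → ∞`, Theorem 1.2 thus establishes Chowla's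
Conjecture along a subsequence, assuming the existence of Siegel zeros» (Remark 1.3).

* `chinis2026_theorem12` — NAMED FACT, Theorem 1.2 AS PRINTED on the tree's objects
  (`IsSiegelZero χ η`, `liouvilleTupleAverage H x = 𝔼_{n ≤ x} ∏_{h ∈ H} λ(n + h)`). The quality
  threshold is rendered as `η > exp(exp 30)` — the hypothesis of Germán–Kátai's Theorem 1.1 «under
  the same assumptions» of which Theorem 1.2 is stated (as reported verbatim in Jaskari–Sachpazis,
  Math. Proc. Cambridge Philos. Soc. 179 (2025), §1); the held tex of [Chinis2026] drops the macro at
  this point («`η_ℓ > ·(30)`»), and `exp(exp 30)` is the larger (hence safe) reading, which is also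
  what makes the window `[q^{10}, q^{(log log η)/3}]` non-empty; `k ≥ 2` and positive shifts as
  printed («distinct (positive) integers»), `q ≥ 2`;
* PROVED readings: `Chinis2026.chowla_frequently_small` — under `UnboundedSiegelZeros`, for every
  such `H` and every `ε > 0` there are arbitrarily large `x` with `|𝔼_{n ≤ x} ∏ λ(n + h)| ≤ ε`
  (Remark 1.3: Chowla along a subsequence, in `liminf` form), and the contrapositive no-go
  `Chinis2026.not_unboundedSiegelZeros_of_chowlaFailure` (a robust failure `|𝔼| ≥ δ` for all large
  `x` bounds the quality of Siegel zeros), parallel to the tree's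
  `Literature.Barriers.Parity.robustChowlaFailure_eliminates` (from Tao–Teräväinen).

Chinis's Theorem 1.1 = Germán–Kátai 2010, Theorem 2 (`k = 2`: `≤ c/log log η_ℓ + ε(x)` on the same
windows) is TYPED in the appended section at the end of this file as `germanKatai2010_theorem2`, from
the verbatim restatement in Tao–Teräväinen's Theorem 1.5 (ii) [TaoTeravainen2021] (second held
reporter: [Chinis2026] Theorem 1.1; the primary [GermanKatai2010] is not held — disclosed there), with
the PROVED reading `GermanKatai2010.twoPoint_frequently_small`. Index only (not typed): Corollary 1.1
(Sarnak's Möbius-disjointness conjecture for deterministic sequences along the same windows — the tree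
has no topological-entropy-of-a-sequence vocabulary; «the proof follows Sarnak's argument verbatim»);
Remark 1.4.

LABEL: instrument / statement layer. WHAT THIS IS NOT: no claim that Siegel zeros exist; superseded
in strength by Tao–Teräväinen (`(log η)^{−1/10}` on `[q^{1/2+ε}, q^{√η}]`) and Jaskari–Sachpazis,
recorded for the literature census of topic I.5; nothing here bears on Chowla unconditionally.

## References

* [Chinis2026] J. Chinis, *Siegel zeros and Sarnak's conjecture*, J. Lond. Math. Soc. (2) 113
  (2026), no. 3, e70479, doi:10.1112/jlms.70479 = arXiv:2105.14653: §1 Theorems 1.1–1.2, Remarks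
  1.3–1.4, Corollary 1.1; §2.
* [GermanKatai2010] L. Germán, I. Kátai, *On multiplicative functions on consecutive integers*,
  Lith. Math. J. 50 (2010), no. 1, 43–53, doi:10.1007/s10986-010-9070-8: Theorem 2 (primary NOT
  held; typed from the restatement «[6, Theorem 2]» in [TaoTeravainen2021] Theorem 1.5 (ii), second
  reporter [Chinis2026] Theorem 1.1).
* [JaskariSachpazis2024] J. Jaskari, S. Sachpazis, *The Chowla conjecture and Landau–Siegel
  zeroes*, Math. Proc. Cambridge Philos. Soc. 179 (2025), §1 (the report of Germán–Kátai's and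
  Chinis's hypotheses and bounds).
* [TaoTeravainen2021] T. Tao, J. Teräväinen, JLMS 106 (2022), Definition 1.4, Theorem 1.5 (ii)
  (the verbatim restatement of Germán–Kátai's Theorem 2), Corollary 1.8(ii).
-/

noncomputable section

open Filter

namespace Literature.NumberTheory.LFunctions

open Literature.Barriers.Parity

/-- **Chinis 2026, Theorem 1.2 (NAMED FACT, as printed).** «Let `{q_ℓ}` be an increasing sequence of
positive integers with corresponding sequence of real primitive characters `{χ_ℓ mod q_ℓ}`. Suppose
that `L(s, χ_ℓ)` has a Siegel zero `β_ℓ := 1 − 1/(η_ℓ log q_ℓ)` with `η_ℓ > exp(exp(30))` for all `ℓ`.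
Then, for any distinct (positive) integers `h₁, …, h_k`, there exists a constant
`c_k = c(h₁, …, h_k) > 0` such that
`(1/x) |∑_{n ≤ x} λ(n+h₁)⋯λ(n+h_k)| ≤ c_k / ((log log η_ℓ)^{1/2} (log η_ℓ)^{1/12})`, uniformly for
`x ∈ [q_ℓ^{10}, q_ℓ^{(log log η_ℓ)/3}]`.» Rendered: for every finite set `H` of positive shifts with
`|H| ≥ 2` there is `C > 0` such that for every `q ≥ 2`, every Siegel zero `IsSiegelZero χ η` mod `q`
with `η > exp(exp 30)` and every natural `x` with `q^{10} ≤ x ≤ q^{(log log η)/3}`: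
`|liouvilleTupleAverage H x| ≤ C / (√(log log η) · (log η)^{1/12})`. (Threshold: see the module
docstring.) Not proved here. [cite: Chinis2026, §1 Theorem 1.2] [cite: JaskariSachpazis2024, §1 (report of the hypotheses of Germán–Kátai and Chinis)] -/
def chinis2026_theorem12 : Prop :=
  ∀ H : Finset ℕ, 2 ≤ H.card → (∀ h ∈ H, 0 < h) →
    ∃ C : ℝ, 0 < C ∧
      ∀ (q : ℕ) [NeZero q], 2 ≤ q → ∀ (χ : DirichletCharacter ℂ q) (η : ℝ), IsSiegelZero χ η →
        Real.exp (Real.exp 30) < η →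
        ∀ x : ℕ, (q : ℝ) ^ (10 : ℝ) ≤ x → (x : ℝ) ≤ (q : ℝ) ^ (Real.log (Real.log η) / 3) →
          |liouvilleTupleAverage H x| ≤
            C / (Real.sqrt (Real.log (Real.log η)) * Real.log η ^ ((1 : ℝ) / 12))

namespace Chinis2026

/-- **Remark 1.3, PROVED modulo Theorem 1.2: Chowla's conjecture along a subsequence.** Under
`UnboundedSiegelZeros` (Siegel zeros of every quality at arbitrarily large conductors), for every
finite set `H` of positive shifts with `|H| ≥ 2` and every `ε > 0` there are arbitrarily large `x`
with `|𝔼_{n ≤ x} ∏_{h ∈ H} λ(n + h)| ≤ ε`: take a Siegel zero of quality `η` with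
`(log η)^{1/12} ≥ C/ε` (and `η > exp(exp 30)`, so `log log η > 30` and the window contains
`x = q^{10}`). [cite: Chinis2026, §1 Theorem 1.2 and Remark 1.3] -/
theorem chowla_frequently_small (h : chinis2026_theorem12) (hU : Summit.Parity.GeneralizedHardyLittlewood.UnboundedSiegelZeros)
    {H : Finset ℕ} (hH : 2 ≤ H.card) (hpos : ∀ h ∈ H, 0 < h) {ε : ℝ} (hε : 0 < ε) (N : ℕ) :
    ∃ x : ℕ, N ≤ x ∧ |liouvilleTupleAverage H x| ≤ ε := by
  obtain ⟨C, hC, hmain⟩ := h H hH hpos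
  -- quality threshold: `η > exp(exp 30)` and `log η ≥ (C/ε)^12`
  set T : ℝ := max (Real.exp (Real.exp 30) + 1) (Real.exp ((C / ε) ^ (12 : ℕ))) with hTdef
  obtain ⟨q, hqne, χ, η, hq, hηT, hSZ⟩ := hU T (max N 2)
  haveI := hqne
  have hq2 : 2 ≤ q := le_trans (le_max_right _ _) hq
  have hqN : N ≤ q := le_trans (le_max_left _ _) hq
  have hη30 : Real.exp (Real.exp 30) < η := by
    have : Real.exp (Real.exp 30) + 1 ≤ T := le_max_left _ _
    linarith
  have hηexp : Real.exp ((C / ε) ^ (12 : ℕ)) ≤ η := (le_max_right _ _).trans hηT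
  have hηpos : 0 < η := lt_trans (Real.exp_pos _) hη30
  -- `log η > exp 30 > 30`, `log log η > 30`
  have hlogη : Real.exp 30 < Real.log η := by
    rw [Real.lt_log_iff_exp_lt hηpos]; exact hη30
  have hlogη0 : 0 < Real.log η := lt_trans (Real.exp_pos _) hlogη
  have hloglogη : 30 < Real.log (Real.log η) := by
    rw [Real.lt_log_iff_exp_lt hlogη0]; exact hlogη
  -- the point `x = q^10` lies in the window
  set x : ℕ := q ^ 10 with hxdef
  have hq1 : (1 : ℝ) ≤ q := by exact_mod_cast le_trans one_le_two hq2
  have hxlo : (q : ℝ) ^ (10 : ℝ) ≤ (x : ℕ) := by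
    rw [hxdef]; push_cast
    rw [show (10 : ℝ) = ((10 : ℕ) : ℝ) by norm_num, Real.rpow_natCast]
  have hxhi : ((x : ℕ) : ℝ) ≤ (q : ℝ) ^ (Real.log (Real.log η) / 3) := by
    rw [hxdef]; push_cast
    rw [← Real.rpow_natCast]
    exact Real.rpow_le_rpow_of_exponent_le hq1 (by push_cast; linarith)
  refine ⟨x, ?_, ?_⟩
  · -- `N ≤ q ≤ q^10`
    calc N ≤ q := hqN
      _ = q ^ 1 := (pow_one q).symm
      _ ≤ q ^ 10 := Nat.pow_le_pow_right (by omega) (by norm_num)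
  · refine (hmain q hq2 χ η hSZ hη30 x hxlo hxhi).trans ?_
    -- `C / (√(log log η) (log η)^{1/12}) ≤ C / (1 · (C/ε)) = ε`
    have hsqrt : 1 ≤ Real.sqrt (Real.log (Real.log η)) := by
      rw [show (1 : ℝ) = Real.sqrt 1 by simp]
      exact Real.sqrt_le_sqrt (by linarith)
    have hpow : C / ε ≤ Real.log η ^ ((1 : ℝ) / 12) := by
      have h1 : (C / ε) ^ (12 : ℕ) ≤ Real.log η := by
        rw [Real.le_log_iff_exp_le hηpos]; exact hηexp
      have hCε : 0 ≤ C / ε := by positivity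
      calc C / ε = ((C / ε) ^ (12 : ℕ)) ^ ((12 : ℕ) : ℝ)⁻¹ :=
          (Real.pow_rpow_inv_natCast hCε (by norm_num)).symm
        _ ≤ Real.log η ^ ((12 : ℕ) : ℝ)⁻¹ := Real.rpow_le_rpow (by positivity) h1 (by positivity)
        _ = Real.log η ^ ((1 : ℝ) / 12) := by norm_num
    have hden : C / ε ≤ Real.sqrt (Real.log (Real.log η)) * Real.log η ^ ((1 : ℝ) / 12) := by
      have h0 : 0 ≤ Real.log η ^ ((1 : ℝ) / 12) := by positivity
      nlinarith
    have hCε0 : 0 < C / ε := by positivity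
    calc C / (Real.sqrt (Real.log (Real.log η)) * Real.log η ^ ((1 : ℝ) / 12))
        ≤ C / (C / ε) := div_le_div_of_nonneg_left hC.le hCε0 hden
      _ = ε := by field_simp

/-- **The no-go reading (contrapositive of Remark 1.3, modulo Theorem 1.2)**: a ROBUST failure of
Chowla's conjecture for one tuple of positive shifts — `|𝔼_{n ≤ x} ∏ λ(n + h)| ≥ δ > 0` for all
large `x` — excludes Siegel zeros of unbounded quality. Parallel to the tree's
`Literature.Barriers.Parity.robustChowlaFailure_eliminates` (Tao–Teräväinen). [cite: Chinis2026, §1 Theorem 1.2 and Remark 1.3] -/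
theorem not_unboundedSiegelZeros_of_chowlaFailure (h : chinis2026_theorem12) {H : Finset ℕ}
    (hH : 2 ≤ H.card) (hpos : ∀ h ∈ H, 0 < h) {δ : ℝ} (hδ : 0 < δ)
    (hfail : ∃ N : ℕ, ∀ x : ℕ, N ≤ x → δ ≤ |liouvilleTupleAverage H x|) :
    ¬ Summit.Parity.GeneralizedHardyLittlewood.UnboundedSiegelZeros := by
  intro hU
  obtain ⟨N, hN⟩ := hfail
  obtain ⟨x, hNx, hx⟩ := chowla_frequently_small h hU hH hpos (half_pos hδ) N
  have := hN x hNx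
  linarith


end Chinis2026

/-! ### Germán–Kátai's two-point bound, as restated by Tao–Teräväinen (appended 2026-08-26) -/

/-- **Germán–Kátai 2010, Theorem 2, AS RESTATED in Tao–Teräväinen's Theorem 1.5 (ii)** (NAMED FACT;
the primary, Lith. Math. J. 50 (2010) 43–53, is not held — disclosed): "Suppose that one has a
Siegel zero `β` with associated conductor `q_χ` and quality `η`. (ii) [6, Theorem 2] One has
`𝔼_{n ≤ x} λ(n)λ(n+1) ≪ 1/log log η + ε(x)` for `q_χ^{10} ≤ x ≤ q_χ^{(log log η)/3}`, where `ε(x)` is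
a quantity that goes to zero as `x → ∞` (uniformly in the choice of Siegel zero)." Rendered: there
are `η₀`, `C` and a sequence `ε : ℕ → ℝ` with `ε(x) → 0` such that for every Siegel zero of quality
`η ≥ η₀` (Definition 1.4; "`η` sufficiently large", §2.1) and every `q^{10} ≤ x ≤ q^{(log log η)/3}`,
`|𝔼_{n ≤ x} λ(n)λ(n+1)| ≤ C/log log η + ε(x)` (the tree's `liouvilleTupleAverage {0, 1} x`). The
`k`-point successor is Chinis's Theorem 1.2 above. [cite: GermanKatai2010, Theorem 2 (as restated in Tao–Teräväinen 2022, Theorem 1.5 (ii))]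
[cite: TaoTeravainen2021, Theorem 1.5 (ii) and §2.1] -/
def germanKatai2010_theorem2 : Prop :=
  ∃ (η₀ C : ℝ) (ε : ℕ → ℝ), Filter.Tendsto ε Filter.atTop (nhds 0) ∧
    ∀ (q : ℕ) [NeZero q] (χ : DirichletCharacter ℂ q) (η : ℝ), IsSiegelZero χ η → η₀ ≤ η →
      ∀ x : ℕ, (q : ℝ) ^ (10 : ℝ) ≤ x → (x : ℝ) ≤ (q : ℝ) ^ (Real.log (Real.log η) / 3) →
        |liouvilleTupleAverage {0, 1} x| ≤ C / Real.log (Real.log η) + ε x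

/-- **Reading** (PROVED modulo the fact): under `UnboundedSiegelZeros`, the two-point Chowla average
`𝔼_{n ≤ x} λ(n)λ(n+1)` is `≤ δ` in absolute value at SOME scale `x ≥ N`, for every `δ > 0` and
every `N` (take a Siegel zero of quality `η` with `C/log log η < δ/2` at a conductor `q ≥ N` with
`ε(x) < δ/2` beyond `q^{10} ≥ N`, and `x = q^{10}`, inside the window as soon as
`log log η ≥ 30`). [cite: TaoTeravainen2021, Theorem 1.5 (ii)] [cite: GermanKatai2010, Theorem 2 (as restated in Tao–Teräväinen 2022, Theorem 1.5 (ii))] -/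
theorem GermanKatai2010.twoPoint_frequently_small (h : germanKatai2010_theorem2)
    (hU : Summit.Parity.GeneralizedHardyLittlewood.UnboundedSiegelZeros) {δ : ℝ} (hδ : 0 < δ) (N : ℕ) :
    ∃ x : ℕ, N ≤ x ∧ |liouvilleTupleAverage {0, 1} x| ≤ δ := by
  obtain ⟨η₀, C, ε, hε, hmain⟩ := h
  -- `ε(x) < δ/2` for `x ≥ X₁`
  have hεev : ∀ᶠ x : ℕ in Filter.atTop, ε x < δ / 2 :=
    hε.eventually (gt_mem_nhds (by linarith))
  obtain ⟨X₁, hX₁⟩ := Filter.eventually_atTop.mp hεev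
  -- quality threshold: `η ≥ η₀`, `log log η ≥ 30`, and `C/log log η < δ/2`
  -- choose `η ≥ T := max η₀ (exp (exp L))` with `L = max 30 (2|C|/δ + 1)`
  set L : ℝ := max 30 (2 * |C| / δ + 1) with hLdef
  have hL30 : 30 ≤ L := le_max_left _ _
  have hLC : 2 * |C| / δ + 1 ≤ L := le_max_right _ _
  obtain ⟨q, inst, χ, η, hq, hη, hS⟩ := hU (max η₀ (Real.exp (Real.exp L))) (max N (max X₁ 2))
  have hη₀ : η₀ ≤ η := le_trans (le_max_left _ _) hη
  have hηexp : Real.exp (Real.exp L) ≤ η := le_trans (le_max_right _ _) hη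
  have hqN : N ≤ q := le_trans (le_max_left _ _) hq
  have hqX : X₁ ≤ q := le_trans (le_trans (le_max_left _ _) (le_max_right _ _)) hq
  have hq2 : 2 ≤ q := le_trans (le_trans (le_max_right _ _) (le_max_right _ _)) hq
  -- `log log η ≥ L`
  have hηpos : 0 < η := lt_of_lt_of_le (Real.exp_pos _) hηexp
  have hll : L ≤ Real.log (Real.log η) := by
    have h1 : Real.exp L ≤ Real.log η := by
      rw [Real.le_log_iff_exp_le hηpos]; exact hηexp
    have h2 : 0 < Real.log η := lt_of_lt_of_le (Real.exp_pos _) h1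
    rw [Real.le_log_iff_exp_le h2]; exact h1
  have hllpos : 0 < Real.log (Real.log η) := by linarith
  -- the scale `x = q^{10}`
  set x : ℕ := q ^ 10 with hxdef
  have hq1 : (1 : ℝ) ≤ q := by exact_mod_cast (show 1 ≤ q by omega)
  have hxcast : (x : ℝ) = (q : ℝ) ^ (10 : ℝ) := by
    rw [hxdef, Nat.cast_pow, show (10 : ℝ) = ((10 : ℕ) : ℝ) by norm_num, Real.rpow_natCast]
  have hxq : q ≤ x := by
    calc q = q ^ 1 := (pow_one q).symm
      _ ≤ q ^ 10 := Nat.pow_le_pow_right (by omega) (by norm_num)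
  have hlo : (q : ℝ) ^ (10 : ℝ) ≤ x := by rw [hxcast]
  have hhi : (x : ℝ) ≤ (q : ℝ) ^ (Real.log (Real.log η) / 3) := by
    rw [hxcast]
    exact Real.rpow_le_rpow_of_exponent_le hq1 (by linarith)
  have hb := hmain q χ η hS hη₀ x hlo hhi
  -- `C/log log η ≤ |C|/L < δ/2` and `ε x < δ/2`
  have h1 : C / Real.log (Real.log η) ≤ δ / 2 := by
    have hCle : C / Real.log (Real.log η) ≤ |C| / Real.log (Real.log η) :=
      div_le_div_of_nonneg_right (le_abs_self C) hllpos.le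
    have h2 : |C| / Real.log (Real.log η) ≤ |C| / L :=
      div_le_div_of_nonneg_left (abs_nonneg C) (by linarith) hll
    have h3 : |C| / L ≤ δ / 2 := by
      rw [div_le_iff₀ (by linarith)]
      have : 2 * |C| / δ ≤ L - 1 := by linarith
      have h4 := (div_le_iff₀ hδ).mp this
      nlinarith [abs_nonneg C]
    linarith
  have h2 : ε x < δ / 2 := hX₁ x (le_trans hqX hxq)
  exact ⟨x, le_trans hqN hxq, by linarith⟩

end Literature.NumberTheory.LFunctions

end
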